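import Mathlib
import Summits.Schanuel.Schanuel.Theses.RigidCore
import Summits.Schanuel.Schanuel.Theorems.AclSubsetLogFreeCore.Negative.LogFreeCoreObjects
import Summits.Schanuel.Schanuel.Theorems.AclSubsetLogFreeCore.Negative.AclSubsetLogFreeCoreIffReal
import Summits.Schanuel.Schanuel.Theorems.RigidCoreAclSubsetLogFreeCoreAclSubsetEclOfEac
import Summits.Schanuel.Schanuel.Theorems.RigidCoreAclSubsetLogFreeCoreCoreAutElementaryOfEac
import Summits.Schanuel.Schanuel.Theorems.RigidCoreAclSubsetLogFreeCoreOfEac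
import Summits.Schanuel.Schanuel.Theorems.RigidCoreAclSubsetLogFreeCoreLogShift
import Summits.Schanuel.Schanuel.Theorems.RigidCoreAclSubsetLogFreeCoreRealiseCopy
import Summits.Schanuel.Schanuel.Theorems.RigidCoreAclSubsetLogFreeCoreCaseI
import Summits.Schanuel.Schanuel.Theorems.RigidCoreAclSubsetLogFreeCoreDoubleBaseAux5
import Summits.Schanuel.Schanuel.Theorems.RigidCoreAclSubsetLogFreeCoreDoubleBase
import Summits.Schanuel.Schanuel.Theorems.RigidCoreAclSubsetLogFreeCoreHullToCore
import Summits.Schanuel.Schanuel.Theorems.RigidCoreAclSubsetLogFreeCoreDoubleRank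
import Summits.Schanuel.Schanuel.Theorems.RigidCoreAclSubsetLogFreeCoreDoubleModelTransport
import Summits.Schanuel.Schanuel.Theorems.RigidCoreAclSubsetLogFreeCoreDoubleModel
import Summits.Schanuel.Schanuel.Theorems.RigidCoreAclSubsetLogFreeCoreCaseIIExpandCoprime
import Summits.Schanuel.Schanuel.Theorems.RigidCoreAclSubsetLogFreeCoreCaseIIMonomialDvd
import Literature.NumberTheory.Transcendental.ZilberField
import Literature.NumberTheory.Transcendental.ZilberFieldQuasiminimal
import Literature.NumberTheory.Transcendental.ZilberFieldAutomorphisms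
import Literature.NumberTheory.Transcendental.GammaIsoCross
import Literature.NumberTheory.Transcendental.GammaFields
import Literature.NumberTheory.Transcendental.ZilberGenericClosedness
import Literature.NumberTheory.Transcendental.PseudoExpVariants

/-!
# Line `eac-extends-core-automorphisms` — skeleton for crux `RigidCore.AclSubsetLogFreeCore`
(stmt-Schanuel-0968), RESHAPED by lead prover-line-stmt-Schanuel-0968-1 (gen 1, 2026-08-16)

## Status inherited from lead -0
* `stub_aclSubsetEcl_of_eac` — CLOSED p71976; `stub_coreAut_elementary_of_eac` — CLOSED p72100;
  transfer `(A) ⟸ EAC ∧ (A₀)` — LANDED p72771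
  (`Summit.Schanuel.Schanuel.Theorems.RigidCore.aclSubsetLogFreeCore_of_eac_of_coreFixedField`);
  residue presentation-independence — LANDED p72560.
* the residue (A₀) `stub_coreFixedField_logFree` was handed back as crux-sized (`promote-stub`).

## The reshape (this lead): (A₀) under ZILBER'S CONJECTURE, split along the E/L/A structure of the core

The standing hypothesis is strengthened from EAC to `stub_zilber : IsZilberField ℂ` (Zilber's
conjecture `ZilberConjecture`; it implies EAC, `IsStronglyExpAlgClosed.isExpAlgClosed`), because the
tree holds a complete engine for constructing core automorphisms of a Zilber field:
hull-to-closure `ZilberAutomorphisms.exists_isEIsoOn_of_isGammaIsoTw₂` (Kirby 2010 Thm 2.1, KMO 2012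
§3.5), cross-field `ℵ₀`-saturation over `ℚτ` `ZilberSaturationLog.isGammaIsoTw₂_saturation_tau'`
(Bays–Kirby Lemma 8.3 for abstract extensions), the countable model `BKModel.exists_countable_seac_model`
over any finitely generated partial exponential field with standard kernel, and the Kummer fact
`BaysKirby2018_divisionSequences_determined_holds`.  Write `τ = 2πi`, `Λ₀ = ℚτ`, `C₀ = ecl ∅`,
`C_EA = logFreeCore`, and `C_ELA` for the ELA-core (smallest subfield `∋ 2πi` closed under `exp`,
under logarithms and relatively algebraically closed; inlined `sInf` below).  (A₀) becomes

  (A₀) ⟸ ZC ∧ [Case I: core-fixed ⟹ `∈ C_ELA`] ∧ [Case II: core-fixed ∧ `∈ C_ELA` ⟹ `∈ C_EA`].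

* Case I is a FREE-AMALGAM ("doubling") argument, provable now: the hull `W ∋ a` over `Λ₀` is free over
  its E/L/A-chain closure `U* ⊆ C_ELA`; an algebraically disjoint abstract copy of `W` over `U*` (a
  partial E-field with standard kernel built inside `ℂ` from a generic field embedding —
  `stub_doubleBase`) is realised in `ℂ` by the countable model (`stub_doubleModel`) + cross
  saturation (`stub_realiseCopy`), giving a Γ-isomorphic partner `W'` of `W` over `U*` whose difference
  with `W` avoids `U*`; hull-to-core (`hullToCore`, proved below from the tree) turns `W ↦ W'` into a core
  automorphism moving every `a ∈ W ∖ U*` (`stub_caseI`).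
* Case II is the ARITHMETIC of the free ELA-closure (Kummer): logarithms `s` of elements algebraic over a
  strong Γ-field shift, `s ↦ s + m·j·2πi` for all `j`, by Γ-isomorphisms (`stub_logShift`, from the Kummer
  fact); with hull-to-core these move everything that depends on a logarithm; the exp-of-algebraic step
  is the remaining research content (`stub_caseII`, held by the lead).

Registered stubs: `stub_zilber` (OPEN, external), `stub_logShift`, `stub_doubleBase`,
`stub_doubleModel`, `stub_realiseCopy`, `stub_caseI` (provable now), `stub_caseII` (hardest, lead).
The composition `AclSubsetLogFreeCore_of` concludes the crux BY NAME; its only `sorry`s are the stubs'.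

## Status at the hand-over to lead c1 (prover-line-stmt-Schanuel-0968-c1-0, 2026-08-16T10:30Z)
* CLOSED (landed by lead -1): `stub_logShift` (`Theorems/RigidCoreAclSubsetLogFreeCoreLogShift`),
  `stub_realiseCopy` (`…RealiseCopy`), `stub_caseI` (`…CaseI`), `hullToCore` (below, sorry-free);
  pieces of `stub_doubleBase`: `…DoubleBaseAux1–5` (generic embedding, copy, `θ`, standard kernel,
  general position, internal strongness); pieces of `stub_doubleModel`: `…DoubleModelTransport`.
* OPEN: `stub_zilber` (hypothesis = Zilber's conjecture; never provable here — the line closes the crux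
  only MODULO it), `stub_doubleBase` (assembly), `stub_doubleModel` (refuter-corrected signature: `hX`
  inserted, DrefuteG4StubDoubleModel.md), `stub_caseII` (lead).

## Disproof used (`Cruxes/AclSubsetLogFreeCore/Disproof.lean`, gen 3, read 2026-08-16)
* §11 Targets: both residues irrefutable today, reduced to REAL elements by `conj` — consistent (our
  automorphisms fix `τ`, `conj` is the other coset).
* §7 `not_branchIndiscernibility` (Kummer parity): `stub_logShift` shifts by `m·j·τ` with `m` supplied by the
  Kummer fact — never claims the shift by `τ` itself.
* §10 `CountableVariant`: finiteness enters through (A₀) being fed only pointwise-definable numbers (transfer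
  p72771); no countable definable set is ever pushed into `C_EA`.
* `_false_without_expClosed` / `_without_period_and_exp`: the conclusion is membership in the genuine `C_EA`.
-/

noncomputable section

set_option linter.dupNamespace false

open FirstOrder FirstOrder.Language Set
open Literature.ModelTheory.ExponentialFields Literature.ModelTheory.ExponentialFields.ExponentialRing
open Literature.NumberTheory.Transcendental Literature.NumberTheory.Transcendental.GammaField
open Summit.Schanuel.Schanuel.Theorems.AclSubsetLogFreeCore.Negative

namespace Summit.Schanuel.Schanuel.Cruxes.AclSubsetLogFreeCore.EacExtendsCoreAutomorphisms

/-! ## Registered stubs -/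

/-- **Stub 1 — Zilber's conjecture for `ℂ_exp`** (`IsZilberField ℂ`: standard kernel, Schanuel
property, strong exponential-algebraic closedness, CCP).  OPEN; external (`ZilberConjecture`); it
implies the old standing hypothesis EAC.  The standing hypothesis of the reshaped line. -/
theorem stub_zilber : IsZilberField ℂ := by
  sorry

/-- **Stub 2 — logarithms shift (Kummer).**  If `exp d` is algebraic over the Γ-field
`ℚ(2πiℚ, c, exp(ℚ·2πi + ℚc))` of `Λ₀ + ℚc` but `d` is not, then for some `m ≥ 1` and EVERY
`j ∈ ℤ`, `(c, d) ↦ (c, d + m j·2πi)` is a Γ-isomorphism over the identity of `ℚ^{ab}(2πi)`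
(all Kummer levels at once).  Provable now (M/L): the Kummer fact
`Literature.FieldTheory.Kummer.BaysKirby2018_divisionSequences_determined_holds` applied to
`b = exp` of a basis of `ℚ·2πi + ℚc` modulo `ℚ·2πi` and `c₀ = exp d` gives `m`; the two division
systems `exp (d/(mk))` and `exp ((d + m j·2πi)/(mk)) = exp (d/(mk))·ζ_k^j` below `exp (d/m)` are
conjugate over `L = E(exp (d/m))`, `E` the Γ-field of `Λ₀ + ℚc` at all levels; `d`, `d + m j·2πi`
are transcendental over `L(all roots)`, so the conjugation extends by `d ↦ d + m j·2πi`; conclude with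
`GammaField.isGammaIsoTw₂_of_ringHom`. (Disproof §7: the shift is by `m·j·2πi`, not by `2πi`.) -/
theorem stub_logShift (τ : ℂ) (hτ : τ = 2 * ↑Real.pi * Complex.I) {N : ℕ} (c : Fin N → ℂ) (d : ℂ)
    (hexp : Complex.exp d ∈ acl (gens (Submodule.span ℚ ({τ} : Set ℂ) ⊔
      Submodule.span ℚ (range c))))
    (hd : d ∉ acl (gens (Submodule.span ℚ ({τ} : Set ℂ) ⊔
      Submodule.span ℚ (range c)))) :
    ∃ m : ℕ, 0 < m ∧ ∀ j : ℤ,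
      IsGammaIsoTw₂ (RingEquiv.refl (fieldOf (Submodule.span ℚ ({τ} : Set ℂ))))
        (Fin.snoc c d) (Fin.snoc c (d + (m : ℂ) * (j : ℂ) * τ)) :=
  -- CLOSED (lead -1): `Theorems/RigidCoreAclSubsetLogFreeCoreLogShift.lean`
  Summit.Schanuel.Schanuel.Theorems.RigidCore.stub_logShift τ hτ c d hexp hd

/-- **Stub 3 — the double, base half (free amalgam of a free strong extension with itself, as a
finitely generated partial exponential field with standard kernel).**  Let `X = ℚ·τ + ℚc ◁ ℂ`
(`τ = 2πi`) and `e` a tuple, `ℚ`-linearly independent over `X`, which is FREE over `X` (no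
non-trivial `ℤ`-combination of `e`, nor its exponential, is algebraic over the Γ-field `ℚ(gens X)`);
put `W = X + ℚe`.  Then there are: a subfield `F ⊆ ℂ` containing `W` and all division points
`exp (x/M!)`, `x ∈ W`; a field `K` with a finite-dimensional `ℚ`-subspace `D`, a partial exponential
`θ` and `t ∈ D` forming an `IsStdKernelPartialExpField`; and two field embeddings `j₁ j₂ : F → K`
("the two copies of `W`") which agree on the generators of the Γ-field of `X` and send `τ ↦ t`,
such that `D` is spanned by `j₁(W) ∪ j₂(W)`, `θ` extends `exp` along both copies, the first copy is
STRONG inside the partial E-field `(K, D, θ)` (predimension inequality for every intermediate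
subspace, stated with the algebraic matroid of `K`), and the copies are in general position:
`Σ qⱼ (j₂ eⱼ − j₁ eⱼ) ∉ ℚt + ℚ j₁(c)` for `q ≠ 0`.  Provable now (XL): with `L = acl (gens X)`
(relatively algebraically closed, countable) and `F = ℚ(L ∪ allGens (c, e))`-type countable field,
take a GENERIC EMBEDDING `φ : F → ℂ` over `L` (send a transcendence basis of `F/L` to elements
chosen successively outside the algebraic closure of `F` — `ℂ` has uncountable transcendence degree —
and extend by `IsAlgClosed.lift`, cf. `BKModel.exists_algHom_of_isTranscendenceBasis`); then
`F ∩ φ(F) = L`, `W ∩ φ(W) = X` (freeness), `D = W + φ(W) = X ⊕ ℚe ⊕ ℚφ(e)` carries the well-defined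
homomorphism `θ = exp` on `W`, `θ = φ ∘ exp ∘ φ⁻¹` on `φ(W)`, whose kernel on `D` is `ℤτ` because `X`
is log-closed in `W` (freeness again); `K = ℚ(D ∪ θ D) ⊆ ℂ`, `j₁ = incl`, `j₂ = φ` (template:
`Literature.Barriers.Schanuel.exists_isStdKernelPartialExpField`); strongness of the first copy
inside `(K, D, θ)` is `X ◁ ℂ` transported by `φ` plus algebraic disjointness of `φ(F)` from `F` over `L`. -/
theorem stub_doubleBase (τ : ℂ) (hτ : τ = 2 * ↑Real.pi * Complex.I)
    {N k : ℕ} (c : Fin N → ℂ) (e : Fin k → ℂ)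
    (hX : IsStrong (Submodule.span ℚ ({τ} : Set ℂ) ⊔ Submodule.span ℚ (range c)))
    (hlin : LinIndepOver (Submodule.span ℚ ({τ} : Set ℂ) ⊔ Submodule.span ℚ (range c)) e)
    (hfree : ∀ m : Fin k → ℤ, m ≠ 0 →
      (∑ j, (m j : ℚ) • e j) ∉ acl (gens (Submodule.span ℚ ({τ} : Set ℂ) ⊔ Submodule.span ℚ (range c))) ∧
      Complex.exp (∑ j, (m j : ℚ) • e j) ∉ acl (gens (Submodule.span ℚ ({τ} : Set ℂ) ⊔
        Submodule.span ℚ (range c)))) :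
    ∃ (F : IntermediateField ℚ ℂ)
      (_ : ∀ x ∈ Submodule.span ℚ ({τ} : Set ℂ) ⊔ Submodule.span ℚ (range (Fin.append c e)),
        x ∈ F ∧ ∀ M : ℕ, Complex.exp (x / (M.factorial : ℂ)) ∈ F)
      (K : Type) (_ : Field K) (_ : CharZero K) (D : Submodule ℚ K) (θ : K → K) (t : K)
      (j₁ j₂ : F →+* K),
      IsStdKernelPartialExpField K D θ t ∧
      (∀ hτF : τ ∈ F, j₁ ⟨τ, hτF⟩ = t ∧ j₂ ⟨τ, hτF⟩ = t) ∧
      (∀ (x : ℂ) (hxF : x ∈ F),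
        (x ∈ Submodule.span ℚ ({τ} : Set ℂ) ⊔ Submodule.span ℚ (range c) ∨
          ∃ y ∈ Submodule.span ℚ ({τ} : Set ℂ) ⊔ Submodule.span ℚ (range c), ∃ M : ℕ,
            x = Complex.exp (y / (M.factorial : ℂ))) →
        j₁ ⟨x, hxF⟩ = j₂ ⟨x, hxF⟩) ∧
      D = Submodule.span ℚ
        ((fun x : F => j₁ x) '' {x : F | (x : ℂ) ∈ Submodule.span ℚ ({τ} : Set ℂ) ⊔
            Submodule.span ℚ (range (Fin.append c e))} ∪
          (fun x : F => j₂ x) '' {x : F | (x : ℂ) ∈ Submodule.span ℚ ({τ} : Set ℂ) ⊔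
            Submodule.span ℚ (range (Fin.append c e))}) ∧
      (∀ (x : ℂ) (hxF : x ∈ F) (hexF : Complex.exp x ∈ F),
        x ∈ Submodule.span ℚ ({τ} : Set ℂ) ⊔ Submodule.span ℚ (range (Fin.append c e)) →
        θ (j₁ ⟨x, hxF⟩) = j₁ ⟨Complex.exp x, hexF⟩ ∧ θ (j₂ ⟨x, hxF⟩) = j₂ ⟨Complex.exp x, hexF⟩) ∧
      (∀ V : Submodule ℚ K,
        Submodule.span ℚ ((fun x : F => j₁ x) '' {x : F | (x : ℂ) ∈ Submodule.span ℚ ({τ} : Set ℂ) ⊔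
            Submodule.span ℚ (range (Fin.append c e))}) ≤ V → V ≤ D →
        ((ldim (Submodule.span ℚ ((fun x : F => j₁ x) '' {x : F | (x : ℂ) ∈ Submodule.span ℚ ({τ} : Set ℂ) ⊔
            Submodule.span ℚ (range (Fin.append c e))})) V : ℕ) : ℕ∞) ≤
          (algMatroid K).relRank
            (↑(Submodule.span ℚ ((fun x : F => j₁ x) '' {x : F | (x : ℂ) ∈ Submodule.span ℚ ({τ} : Set ℂ) ⊔
              Submodule.span ℚ (range (Fin.append c e))})) ∪
              θ '' ↑(Submodule.span ℚ ((fun x : F => j₁ x) '' {x : F | (x : ℂ) ∈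
                Submodule.span ℚ ({τ} : Set ℂ) ⊔ Submodule.span ℚ (range (Fin.append c e))})))
            (↑V ∪ θ '' ↑V)) ∧
      (∀ (hcF : ∀ i, c i ∈ F) (heF : ∀ j, e j ∈ F) (q : Fin k → ℚ), q ≠ 0 →
        (∑ j, q j • (j₂ ⟨e j, heF j⟩ - j₁ ⟨e j, heF j⟩)) ∉
          Submodule.span ℚ ({t} : Set K) ⊔ Submodule.span ℚ (range fun i => j₁ ⟨c i, hcF i⟩)) :=
  -- CLOSED (lead -1, p97139, accepted 2026-08-16T10:43Z): `Theorems/RigidCoreAclSubsetLogFreeCoreDoubleBase.lean`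
  Summit.Schanuel.Schanuel.Theorems.RigidCore.stub_doubleBase τ hτ c e hX hlin hfree

/-- **Stub 4 — the double, model half (Bays–Kirby's countable model over the double base).**  From
the data of Stub 3 — together with `δ(e/X) = 0` — there is an exponential field `M` (Bays–Kirby's
`M(F_base)`: `BKModel.exists_countable_seac_model` over `(K, D, θ, t)`, with embedding `ιM : K → M`,
`exp ∘ ιM = ιM ∘ θ` on `D`, kernel `ιM(t)ℤ`, `span (ιM '' D) ◁ M`) with kernel `τ₁ℤ`, an isomorphism
`σ₀ : ℚ^{ab}(τ₁) ≅ ℚ^{ab}(τ)` of base Γ-fields, and tuples `c₁ = ιM j₁ c`, `e₁ = ιM j₁ e`,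
`e₂ = ιM j₂ e` such that both `(c₁, e₁)` and `(c₁, e₂)` are Γ-isomorphic over `σ₀` to `(c, e)`
(`GammaField.isGammaIsoTw₂_of_ringHom` through `(ιM ∘ jᵢ)⁻¹`, the relevant generated subfields lying in
the range), `ℚτ₁ + ℚc₁ + ℚe₁ ◁ M` (from `span (ιM '' D) ◁ M` and the internal strongness clause of
Stub 3, via submodularity `predim_sup_le` and invariance of algebraic rank under `ιM`),
`δ(e₂ / ℚτ₁ + ℚc₁ + ℚe₁) = 0` (`≥ 0` as before, `≤ 0` from `δ(e/X) = 0` transported by `ιM ∘ j₂`), and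
the general-position clause transported by `ιM`.  Provable now (L/XL).
RESHAPED (refuter drefute gen 4, `DrefuteG4StubDoubleModel.md`): the hypothesis `hX` (the base
`X = ℚτ + ℚc` is strong in `ℂ`) is inserted — without it a δ-drop inside `W` would allow
`δ(e₂/W₁) > 0`; with it `δ(D/j₁W) ≤ −δ(I₂/X) ≤ 0` (`I₂ = {y ∈ W : j₂ y ∈ j₁ W}`), and `≥ 0` is
`hstrong` at `V = D`.  The only caller `doubling` holds `hX`.
RESHAPED further (lead c1): the rank inequality "`δ(D/j₁W) ≤ 0` inside `K`" is split off as the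
separate registered stub `stub_doubleRank` (pure Γ-field bookkeeping in `K` and `ℂ`, no model), and
enters here as the hypothesis `hrank`; this stub is then the model construction + transport only. -/
theorem stub_doubleRank (τ : ℂ) {N k : ℕ} (c : Fin N → ℂ) (e : Fin k → ℂ)
    (hX : IsStrong (Submodule.span ℚ ({τ} : Set ℂ) ⊔ Submodule.span ℚ (range c)))
    (hlin : LinIndepOver (Submodule.span ℚ ({τ} : Set ℂ) ⊔ Submodule.span ℚ (range c)) e)
    (hδ : predim (Submodule.span ℚ ({τ} : Set ℂ) ⊔ Submodule.span ℚ (range c))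
      (Submodule.span ℚ (range e)) = 0)
    (F : IntermediateField ℚ ℂ)
    (hFW : ∀ x ∈ Submodule.span ℚ ({τ} : Set ℂ) ⊔ Submodule.span ℚ (range (Fin.append c e)),
      x ∈ F ∧ ∀ M : ℕ, Complex.exp (x / (M.factorial : ℂ)) ∈ F)
    (K : Type) [Field K] [CharZero K] (D : Submodule ℚ K) (θ : K → K) (t : K) (j₁ j₂ : F →+* K)
    (hK : IsStdKernelPartialExpField K D θ t)
    (hjτ : ∀ hτF : τ ∈ F, j₁ ⟨τ, hτF⟩ = t ∧ j₂ ⟨τ, hτF⟩ = t)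
    (hagree : ∀ (x : ℂ) (hxF : x ∈ F),
      (x ∈ Submodule.span ℚ ({τ} : Set ℂ) ⊔ Submodule.span ℚ (range c) ∨
        ∃ y ∈ Submodule.span ℚ ({τ} : Set ℂ) ⊔ Submodule.span ℚ (range c), ∃ M : ℕ,
          x = Complex.exp (y / (M.factorial : ℂ))) →
      j₁ ⟨x, hxF⟩ = j₂ ⟨x, hxF⟩)
    (hD : D = Submodule.span ℚ
      ((fun x : F => j₁ x) '' {x : F | (x : ℂ) ∈ Submodule.span ℚ ({τ} : Set ℂ) ⊔
          Submodule.span ℚ (range (Fin.append c e))} ∪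
        (fun x : F => j₂ x) '' {x : F | (x : ℂ) ∈ Submodule.span ℚ ({τ} : Set ℂ) ⊔
          Submodule.span ℚ (range (Fin.append c e))}))
    (hθ : ∀ (x : ℂ) (hxF : x ∈ F) (hexF : Complex.exp x ∈ F),
      x ∈ Submodule.span ℚ ({τ} : Set ℂ) ⊔ Submodule.span ℚ (range (Fin.append c e)) →
      θ (j₁ ⟨x, hxF⟩) = j₁ ⟨Complex.exp x, hexF⟩ ∧ θ (j₂ ⟨x, hxF⟩) = j₂ ⟨Complex.exp x, hexF⟩) :
    (algMatroid K).relRank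
        (↑(Submodule.span ℚ ((fun x : F => j₁ x) '' {x : F | (x : ℂ) ∈ Submodule.span ℚ ({τ} : Set ℂ) ⊔
          Submodule.span ℚ (range (Fin.append c e))})) ∪
          θ '' ↑(Submodule.span ℚ ((fun x : F => j₁ x) '' {x : F | (x : ℂ) ∈
            Submodule.span ℚ ({τ} : Set ℂ) ⊔ Submodule.span ℚ (range (Fin.append c e))})))
        (↑D ∪ θ '' ↑D) ≤
      ((ldim (Submodule.span ℚ ((fun x : F => j₁ x) '' {x : F | (x : ℂ) ∈ Submodule.span ℚ ({τ} : Set ℂ) ⊔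
          Submodule.span ℚ (range (Fin.append c e))})) D : ℕ) : ℕ∞) :=
  -- CLOSED (c1 wave 1, p99070): `Theorems/RigidCoreAclSubsetLogFreeCoreDoubleRank.lean`
  Summit.Schanuel.Schanuel.Theorems.RigidCore.stub_doubleRank τ c e hX hlin hδ F hFW K D θ t j₁ j₂ hK hjτ
    hagree hD hθ

/-- **Stub 4 — the double, model half** (see the docstring above `stub_doubleRank`; `hrank` is the
conclusion of `stub_doubleRank`). -/
theorem stub_doubleModel (τ : ℂ) {N k : ℕ} (c : Fin N → ℂ) (e : Fin k → ℂ)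
    (hX : IsStrong (Submodule.span ℚ ({τ} : Set ℂ) ⊔ Submodule.span ℚ (range c)))
    (hlin : LinIndepOver (Submodule.span ℚ ({τ} : Set ℂ) ⊔ Submodule.span ℚ (range c)) e)
    (hδ : predim (Submodule.span ℚ ({τ} : Set ℂ) ⊔ Submodule.span ℚ (range c))
      (Submodule.span ℚ (range e)) = 0)
    (F : IntermediateField ℚ ℂ)
    (hFW : ∀ x ∈ Submodule.span ℚ ({τ} : Set ℂ) ⊔ Submodule.span ℚ (range (Fin.append c e)),
      x ∈ F ∧ ∀ M : ℕ, Complex.exp (x / (M.factorial : ℂ)) ∈ F)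
    (K : Type) [Field K] [CharZero K] (D : Submodule ℚ K) (θ : K → K) (t : K) (j₁ j₂ : F →+* K)
    (hK : IsStdKernelPartialExpField K D θ t)
    (hjτ : ∀ hτF : τ ∈ F, j₁ ⟨τ, hτF⟩ = t ∧ j₂ ⟨τ, hτF⟩ = t)
    (hagree : ∀ (x : ℂ) (hxF : x ∈ F),
      (x ∈ Submodule.span ℚ ({τ} : Set ℂ) ⊔ Submodule.span ℚ (range c) ∨
        ∃ y ∈ Submodule.span ℚ ({τ} : Set ℂ) ⊔ Submodule.span ℚ (range c), ∃ M : ℕ,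
          x = Complex.exp (y / (M.factorial : ℂ))) →
      j₁ ⟨x, hxF⟩ = j₂ ⟨x, hxF⟩)
    (hD : D = Submodule.span ℚ
      ((fun x : F => j₁ x) '' {x : F | (x : ℂ) ∈ Submodule.span ℚ ({τ} : Set ℂ) ⊔
          Submodule.span ℚ (range (Fin.append c e))} ∪
        (fun x : F => j₂ x) '' {x : F | (x : ℂ) ∈ Submodule.span ℚ ({τ} : Set ℂ) ⊔
          Submodule.span ℚ (range (Fin.append c e))}))
    (hθ : ∀ (x : ℂ) (hxF : x ∈ F) (hexF : Complex.exp x ∈ F),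
      x ∈ Submodule.span ℚ ({τ} : Set ℂ) ⊔ Submodule.span ℚ (range (Fin.append c e)) →
      θ (j₁ ⟨x, hxF⟩) = j₁ ⟨Complex.exp x, hexF⟩ ∧ θ (j₂ ⟨x, hxF⟩) = j₂ ⟨Complex.exp x, hexF⟩)
    (hstrong : ∀ V : Submodule ℚ K,
      Submodule.span ℚ ((fun x : F => j₁ x) '' {x : F | (x : ℂ) ∈ Submodule.span ℚ ({τ} : Set ℂ) ⊔
          Submodule.span ℚ (range (Fin.append c e))}) ≤ V → V ≤ D →
      ((ldim (Submodule.span ℚ ((fun x : F => j₁ x) '' {x : F | (x : ℂ) ∈ Submodule.span ℚ ({τ} : Set ℂ) ⊔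
          Submodule.span ℚ (range (Fin.append c e))})) V : ℕ) : ℕ∞) ≤
        (algMatroid K).relRank
          (↑(Submodule.span ℚ ((fun x : F => j₁ x) '' {x : F | (x : ℂ) ∈ Submodule.span ℚ ({τ} : Set ℂ) ⊔
            Submodule.span ℚ (range (Fin.append c e))})) ∪
            θ '' ↑(Submodule.span ℚ ((fun x : F => j₁ x) '' {x : F | (x : ℂ) ∈
              Submodule.span ℚ ({τ} : Set ℂ) ⊔ Submodule.span ℚ (range (Fin.append c e))})))
          (↑V ∪ θ '' ↑V))
    (hnov : ∀ (hcF : ∀ i, c i ∈ F) (heF : ∀ j, e j ∈ F) (q : Fin k → ℚ), q ≠ 0 →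
      (∑ j, q j • (j₂ ⟨e j, heF j⟩ - j₁ ⟨e j, heF j⟩)) ∉
        Submodule.span ℚ ({t} : Set K) ⊔ Submodule.span ℚ (range fun i => j₁ ⟨c i, hcF i⟩))
    (hrank : (algMatroid K).relRank
        (↑(Submodule.span ℚ ((fun x : F => j₁ x) '' {x : F | (x : ℂ) ∈ Submodule.span ℚ ({τ} : Set ℂ) ⊔
          Submodule.span ℚ (range (Fin.append c e))})) ∪
          θ '' ↑(Submodule.span ℚ ((fun x : F => j₁ x) '' {x : F | (x : ℂ) ∈
            Submodule.span ℚ ({τ} : Set ℂ) ⊔ Submodule.span ℚ (range (Fin.append c e))})))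
        (↑D ∪ θ '' ↑D) ≤
      ((ldim (Submodule.span ℚ ((fun x : F => j₁ x) '' {x : F | (x : ℂ) ∈ Submodule.span ℚ ({τ} : Set ℂ) ⊔
          Submodule.span ℚ (range (Fin.append c e))})) D : ℕ) : ℕ∞)) :
    ∃ (M : Type) (_ : Field M) (_ : CharZero M) (_ : ExponentialRing M) (τ₁ : M)
      (σ₀ : fieldOf (Submodule.span ℚ ({τ₁} : Set M)) ≃+*
        fieldOf (Submodule.span ℚ ({τ} : Set ℂ)))
      (c₁ : Fin N → M) (e₁ e₂ : Fin k → M),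
      expKernel M = AddSubgroup.zmultiples τ₁ ∧ τ₁ ≠ 0 ∧
      IsEBaseIso₂ (Submodule.span ℚ ({τ₁} : Set M))
        (Submodule.span ℚ ({τ} : Set ℂ)) σ₀ ∧
      IsGammaIsoTw₂ σ₀ (Fin.append c₁ e₁) (Fin.append c e) ∧
      IsGammaIsoTw₂ σ₀ (Fin.append c₁ e₂) (Fin.append c e) ∧
      IsStrong (Submodule.span ℚ ({τ₁} : Set M) ⊔ Submodule.span ℚ (range (Fin.append c₁ e₁))) ∧
      predim (Submodule.span ℚ ({τ₁} : Set M) ⊔ Submodule.span ℚ (range (Fin.append c₁ e₁)))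
        (Submodule.span ℚ (range e₂)) = 0 ∧
      ∀ q : Fin k → ℚ, q ≠ 0 →
        (∑ j, q j • (e₂ j - e₁ j)) ∉ Submodule.span ℚ ({τ₁} : Set M) ⊔ Submodule.span ℚ (range c₁) := by
  -- CLOSED (c1 wave 1, p99397): `Theorems/RigidCoreAclSubsetLogFreeCoreDoubleModel.lean`
  exact Summit.Schanuel.Schanuel.Theorems.RigidCore.stub_doubleModel τ c e hX hlin hδ F hFW K D θ t j₁ j₂ hK
    hjτ hagree hD hθ hstrong hnov hrank

/-- **Stub 5 — realising the abstract copy in `ℂ` (cross-field saturation + composition).**  In the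
situation produced by Stub 4, if `ℂ_exp` is a Zilber field then the second copy `e₂` is realised in
`ℂ` over `(c, e)`: there is `e'` with `(c, e) ↦ (c, e')` a Γ-isomorphism over the identity of
`ℚ^{ab}(2πi)`, `ℚ·2πi + ℚc + ℚe' ◁ ℂ`, and `Σ qⱼ(e'ⱼ − eⱼ) ∉ ℚ·2πi + ℚc` for `q ≠ 0`.  Provable now (L):
`ZilberSaturationLog.isGammaIsoTw₂_saturation_tau'` with `F₁ = M`, `F₂ = ℂ` (algebraically closed,
`isSurjectiveOntoUnits_complex`, SEAC from `hZ`), base point `(c₁, e₁) ↦ (c, e)` and extension `e₂`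
gives `E'`; `IsGammaIsoTw₂.comp` (sub-tuple `(c₁, e₂) ↦ (c, E')`), `.symm`, `.trans₂` with the second
copy's Γ-isomorphism and `σ₀.symm.trans σ₀ = refl` give `(c, e) ↦ (c, E')`; strongness of
`X + ℚE'` from `hX` by `IsStrong.of_predim_eq_zero` (`δ` is a Γ-isomorphism invariant,
`IsGammaIsoTw₂.td_sup_span_eq`, and `hδe`); the general-position clause transports along the big
Γ-isomorphism (`ℚ`-linear relations with a `2πi`-term are level-0 polynomial relations over the base;
`σ₀ τ₁ = ±2πi` by `IsEBaseIso₂`). -/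
theorem stub_realiseCopy (hZ : IsZilberField ℂ) (τ : ℂ) (hτ : τ = 2 * ↑Real.pi * Complex.I)
    (M : Type) [Field M] [CharZero M] [ExponentialRing M] (τ₁ : M)
    (hker : expKernel M = AddSubgroup.zmultiples τ₁) (hτ₁ : τ₁ ≠ 0)
    (σ₀ : fieldOf (Submodule.span ℚ ({τ₁} : Set M)) ≃+*
      fieldOf (Submodule.span ℚ ({τ} : Set ℂ)))
    (hσ₀ : IsEBaseIso₂ (Submodule.span ℚ ({τ₁} : Set M))
      (Submodule.span ℚ ({τ} : Set ℂ)) σ₀)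
    {N k : ℕ} (c₁ : Fin N → M) (e₁ e₂ : Fin k → M) (c : Fin N → ℂ) (e : Fin k → ℂ)
    (h₁ : IsGammaIsoTw₂ σ₀ (Fin.append c₁ e₁) (Fin.append c e))
    (h₂ : IsGammaIsoTw₂ σ₀ (Fin.append c₁ e₂) (Fin.append c e))
    (hsM : IsStrong (Submodule.span ℚ ({τ₁} : Set M) ⊔ Submodule.span ℚ (range (Fin.append c₁ e₁))))
    (hδM : predim (Submodule.span ℚ ({τ₁} : Set M) ⊔ Submodule.span ℚ (range (Fin.append c₁ e₁)))
      (Submodule.span ℚ (range e₂)) = 0)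
    (hnew : ∀ q : Fin k → ℚ, q ≠ 0 →
      (∑ j, q j • (e₂ j - e₁ j)) ∉ Submodule.span ℚ ({τ₁} : Set M) ⊔ Submodule.span ℚ (range c₁))
    (hX : IsStrong (Submodule.span ℚ ({τ} : Set ℂ) ⊔ Submodule.span ℚ (range c)))
    (hXe : IsStrong (Submodule.span ℚ ({τ} : Set ℂ) ⊔
      Submodule.span ℚ (range (Fin.append c e))))
    (hδe : predim (Submodule.span ℚ ({τ} : Set ℂ) ⊔ Submodule.span ℚ (range c))
      (Submodule.span ℚ (range e)) = 0) :
    ∃ e' : Fin k → ℂ,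
      IsGammaIsoTw₂ (RingEquiv.refl (fieldOf (Submodule.span ℚ ({τ} : Set ℂ))))
        (Fin.append c e) (Fin.append c e') ∧
      IsStrong (Submodule.span ℚ ({τ} : Set ℂ) ⊔
        Submodule.span ℚ (range (Fin.append c e'))) ∧
      ∀ q : Fin k → ℚ, q ≠ 0 →
        (∑ j, q j • (e' j - e j)) ∉
          Submodule.span ℚ ({τ} : Set ℂ) ⊔ Submodule.span ℚ (range c) :=
  -- CLOSED (lead -1): `Theorems/RigidCoreAclSubsetLogFreeCoreRealiseCopy.lean`
  Summit.Schanuel.Schanuel.Theorems.RigidCore.stub_realiseCopy hZ τ hτ M τ₁ hker hτ₁ σ₀ hσ₀ c₁ e₁ e₂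
    c e h₁ h₂ hsM hδM hnew hX hXe hδe

/-- **Stub 6 — Case I: core-fixed elements are ELA (doubling ⟹ genericity).**  Under Zilber's
conjecture, granted hull-to-core (`hH2C`, proved below from the tree) and the doubling principle
(`hD` = Stubs 3+4+5), every element of `ecl ∅` fixed by all exponential-field automorphisms of
`C₀ = ecl ∅` lies in the ELA-core `C_ELA` = the smallest subfield of `ℂ` containing `2πi` which is
closed under `exp`, relatively algebraically closed, and closed under logarithms.  Provable now (L):
Schanuel (`hZ.schanuelProperty`, `schanuelProperty_iff_isStrong_span_kernelGenerator`) makes `Λ₀ = ℚ·2πi`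
strong; take a hull `W ∋ a` with `δ(W/Λ₀) = 0`, `W ◁ ℂ`, inside `span (ecl ∅)`
(`exists_predim_eq_zero_of_mem_ecl_of_isStrong` / `IsStrong.exists_isStrong_of_le`, `isStrong_span_ecl`,
`ax_schanuel_holds`); let `U*` be the closure of `Λ₀` inside `W` under "`v ∈ W` algebraic over
`ℚ(gens U)`" and "`v ∈ W` with `exp v` algebraic over `ℚ(gens U)`" (finite-dimensional induction; each
step has `δ = 0`, so `U* ◁ ℂ`, `δ(W/U*) = 0`, and `U* ⊆ C_ELA` by the closure properties of `C_ELA`);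
`W` is free over `U*` by maximality; if `a ∉ U*` write `a = u + Σ qⱼ eⱼ` (`e` a basis of `W` mod `U*`,
`q ≠ 0`), get `e'` from `hD` and `g` from `hH2C` with `g = id` on `U*`, `g eⱼ = e'ⱼ`; `g` is `ℚ`-linear on
`ecl ∅ ⊇ W`, so `g a − a = Σ qⱼ(e'ⱼ − eⱼ) ∉ U* ∋ 0` — contradiction with `g a = a`. -/
theorem stub_caseI (hZ : IsZilberField ℂ) (τ : ℂ) (hτ : τ = 2 * ↑Real.pi * Complex.I)
    (hH2C : ∀ {N : ℕ} {c c' : Fin N → ℂ},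
      IsGammaIsoTw₂ (RingEquiv.refl (fieldOf (Submodule.span ℚ ({τ} : Set ℂ)))) c c' →
      IsStrong (Submodule.span ℚ ({τ} : Set ℂ) ⊔ Submodule.span ℚ (range c)) →
      IsStrong (Submodule.span ℚ ({τ} : Set ℂ) ⊔ Submodule.span ℚ (range c')) →
      ∃ g : ℂ → ℂ, IsEIsoOn g (ecl (∅ : Set ℂ)) (ecl (∅ : Set ℂ)) ∧ ∀ j, g (c j) = c' j)
    (hD : ∀ {N k : ℕ} (c : Fin N → ℂ) (e : Fin k → ℂ),
      IsStrong (Submodule.span ℚ ({τ} : Set ℂ) ⊔ Submodule.span ℚ (range c)) →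
      IsStrong (Submodule.span ℚ ({τ} : Set ℂ) ⊔
        Submodule.span ℚ (range (Fin.append c e))) →
      LinIndepOver (Submodule.span ℚ ({τ} : Set ℂ) ⊔ Submodule.span ℚ (range c)) e →
      predim (Submodule.span ℚ ({τ} : Set ℂ) ⊔ Submodule.span ℚ (range c))
        (Submodule.span ℚ (range e)) = 0 →
      (∀ m : Fin k → ℤ, m ≠ 0 →
        (∑ j, (m j : ℚ) • e j) ∉ acl (gens (Submodule.span ℚ ({τ} : Set ℂ) ⊔
          Submodule.span ℚ (range c))) ∧
        Complex.exp (∑ j, (m j : ℚ) • e j) ∉ acl (gens (Submodule.span ℚ ({τ} : Set ℂ) ⊔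
          Submodule.span ℚ (range c)))) →
      ∃ e' : Fin k → ℂ,
        IsGammaIsoTw₂ (RingEquiv.refl (fieldOf (Submodule.span ℚ ({τ} : Set ℂ))))
          (Fin.append c e) (Fin.append c e') ∧
        IsStrong (Submodule.span ℚ ({τ} : Set ℂ) ⊔
          Submodule.span ℚ (range (Fin.append c e'))) ∧
        ∀ q : Fin k → ℚ, q ≠ 0 →
          (∑ j, q j • (e' j - e j)) ∉
            Submodule.span ℚ ({τ} : Set ℂ) ⊔ Submodule.span ℚ (range c)) :
    ∀ a ∈ ecl (∅ : Set ℂ),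
      (∀ g : ℂ → ℂ, IsEIsoOn g (ecl (∅ : Set ℂ)) (ecl (∅ : Set ℂ)) → g a = a) →
        a ∈ (sInf {K : IntermediateField ℚ ℂ | (2 * ↑Real.pi * Complex.I : ℂ) ∈ K ∧
          (∀ w ∈ K, Complex.exp w ∈ K) ∧ (∀ w : ℂ, IsAlgebraic K w → w ∈ K) ∧
          (∀ w : ℂ, Complex.exp w ∈ K → w ∈ K)} : IntermediateField ℚ ℂ) :=
  -- CLOSED (lead -1): `Theorems/RigidCoreAclSubsetLogFreeCoreCaseI.lean`
  Summit.Schanuel.Schanuel.Theorems.RigidCore.stub_caseI hZ τ hτ hH2C hD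

/-! ### Stub 7 — Case II (RESHAPED by lead c1, 2026-08-16: the monolithic `stub_caseII`
`(hZ) (τ) (hτ) (hH2C) (hLS) : ∀ a ∈ ecl ∅, a ∈ C_ELA → core-fixed → a ∈ logFreeCore` is split into
`stub_caseII_core` (abstract difference algebra, lead) + `stub_caseII_reduce` (chains / minimal hull /
deformation in a zero-dimensional Zilber field) + `stub_caseII_transfer` (`ecl ∅ ⊆ ℂ` ↔ abstract),
assembled in `caseII_of_stubs`; the engines `hH2C`/`hLS` are no longer threaded through — the abstract
route takes them from `IsZilberField (ecl ∅)` directly (`IsZilberField.eclSubfield_isZilberField`,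
`ZilberAutomorphisms.exists_isEIsoOn_of_isGammaIsoTw₂`, `logShift_isGammaIso`).  Lead -1's landed
sub-goals `caseII_Lstep`, `caseII_affineKill`, `caseII_algPartner` serve `stub_caseII_core` (level 0)
and `stub_caseII_reduce` (A-step partners). -/

/-- **Stub 7a′ — pure algebra for the core claim: `expand` preserves coprimality.** Over an
algebraically closed field `k` of characteristic `0`, if two multivariate polynomials `P, Q` are
relatively prime then so are `P(Xᵉ)` and `Q(Xᵉ)` (`MvPolynomial.expand e`, `e ≥ 1`).  Used in the
core claim to pass between the Laurent-monomial coordinate rings `k[exp(b/N)]` and `k[exp(b/(Ne))]`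
of one level of the tower (persistence of lowest-terms representations under refinement).
Proof sketch: a common irreducible factor `π` of `P(Xᵉ)`, `Q(Xᵉ)` has norm
`N(π) = ∏_{ζ ∈ μₑᵖ} π(ζ • X)` invariant under all scalings `Xᵢ ↦ ζᵢ Xᵢ` (`ζᵢᵉ = 1`), hence of the
form `D(Xᵉ)` (support in `eℕᵖ`); `D(Xᵉ) ∣ P(Xᵉ)^{eᵖ}` forces `D ∣ P^{eᵖ}` (`k[Xᵉ] ⊆ k[X]` is free on
monomials), likewise for `Q`, so `D`, `N(π)`, `π` are units. -/
theorem stub_caseII_expandCoprime {k : Type} [Field k] [IsAlgClosed k] [CharZero k] {p e : ℕ}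
    (he : 0 < e) {P Q : MvPolynomial (Fin p) k} (h : IsRelPrime P Q) :
    IsRelPrime (MvPolynomial.expand e P) (MvPolynomial.expand e Q) :=
  -- CLOSED (c1, p103284): `Theorems/RigidCoreAclSubsetLogFreeCoreCaseIIExpandCoprime.lean`
  Summit.Schanuel.Schanuel.Theorems.RigidCore.stub_caseII_expandCoprime he h

/-- **Stub 7a″ — pure algebra for the core claim: divisors of monomials are monomials.** In a
multivariate polynomial ring over a field, if `f * g` is a non-zero monomial then `f` is a non-zero
constant times a monomial (units of the Laurent-monomial localisation are the monomials).  Proof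
sketch: unique sums in `ℕᵖ` (`TwoUniqueSums`) — a factor with two terms gives a product with two
terms. -/
theorem stub_caseII_monomialDvd {k : Type} [Field k] {p : ℕ} {f g : MvPolynomial (Fin p) k}
    {d : Fin p →₀ ℕ} {c : k} (hc : c ≠ 0) (h : f * g = MvPolynomial.monomial d c) :
    ∃ (d' : Fin p →₀ ℕ) (c' : k), c' ≠ 0 ∧ f = MvPolynomial.monomial d' c' :=
  -- CLOSED (c1, p103027): `Theorems/RigidCoreAclSubsetLogFreeCoreCaseIIMonomialDvd.lean`
  Summit.Schanuel.Schanuel.Theorems.RigidCore.stub_caseII_monomialDvd hc h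

/-- **Stub 7a‴ — fractions in lowest terms for the field `K = k(exp Y'')`** (one level of the
canonical tower, abstracted as in `…CaseIIMonomials`/`…CaseIILaurent`): every element `z` of the
subfield generated by `k` and `exp Y''` is a quotient `P(t)/Q(t)` of polynomials over `k` in the
level-`N` coordinates `tᵢ = exp (bᵢ / N)` (some `N ≥ 1`) with `P, Q` RELATIVELY PRIME and `Q(t) ≠ 0`.
Provable now (M): closure induction gives some fraction (Laurent closure lemmas of `…CaseIILaurent`);
`MvPolynomial (Fin p) k` is a UFD/GCD domain, divide `P, Q` by their `gcd`. -/
theorem stub_caseII_fractions {E : Type*} [Field E] [CharZero E] [ExponentialRing E]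
    (k : Subfield E) {Y' Y'' : Submodule ℚ E} {p : ℕ} (b : Fin p → E)
    (hbspan : ∀ y ∈ Y'', ∃ r : Fin p → ℚ, y - ∑ i, r i • b i ∈ Y')
    (hexpY' : ∀ y ∈ Y', exp y ∈ k) {z : E}
    (hz : z ∈ Subfield.closure ((k : Set E) ∪ exp '' (Y'' : Set E))) :
    ∃ N : ℕ, 0 < N ∧ ∃ (P Q : MvPolynomial (Fin p) k), IsRelPrime P Q ∧
      MvPolynomial.aeval (fun i => exp ((1 / (N : ℚ)) • b i)) Q ≠ 0 ∧
      z * MvPolynomial.aeval (fun i => exp ((1 / (N : ℚ)) • b i)) Q =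
        MvPolynomial.aeval (fun i => exp ((1 / (N : ℚ)) • b i)) P := by
  sorry

/-- **Stub 7a⁗ — the denominator of a semi-invariant fraction is semi-invariant** (one level of the
tower, abstracted; `θ` an exponential automorphism stabilising `k` and `Y''`, level coordinates
algebraically independent over `k`, plus the two pure-algebra facts `hEC` = Stub 7a′ and `hMD` =
Stub 7a″ as hypotheses): if `z = P(t)/Q(t)` in lowest terms and `θ z = (c₀ exp y₀) z` with
`c₀ ∈ kˣ`, `y₀ ∈ Y''`, then `θ (Q(t)) = (c exp y) Q(t)` for some `c ∈ kˣ`, `y ∈ Y''`.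
Provable now (M/L): `θ` maps `P(t)`, `Q(t)` to Laurent polynomials `P'(t')/t'^A`, `Q'(t')/t'^B` at a
finer level `N e` (`…CaseIILaurent.exists_laurent_map`); cross-multiplying the semi-invariance and
the persistence of coprimality under `expand e` (`hEC`) give `Q(Xᵉ) ∣ Q' · monomial` and
`Q' ∣ Q(Xᵉ) · monomial` in the UFD `k[X]`; comparing, `Q' = unit · monomial · Q(Xᵉ)` up to monomial
factors (`hMD`: divisors of monomials are monomials), i.e. `θ (Q(t)) = c · exp y · Q(t)`. -/
theorem stub_caseII_denominator {E : Type*} [Field E] [CharZero E] [ExponentialRing E]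
    (k : Subfield E) {Y' Y'' : Submodule ℚ E} {p : ℕ} (b : Fin p → E)
    (hbspan : ∀ y ∈ Y'', ∃ r : Fin p → ℚ, y - ∑ i, r i • b i ∈ Y') (hbY : ∀ i, b i ∈ Y'')
    (hexpY' : ∀ y ∈ Y', exp y ∈ k)
    (hAI : ∀ N : ℕ, 0 < N → AlgebraicIndependent k (fun i => exp ((1 / (N : ℚ)) • b i)))
    (hEC : ∀ {e : ℕ}, 0 < e → ∀ {P Q : MvPolynomial (Fin p) k}, IsRelPrime P Q →
      IsRelPrime (MvPolynomial.expand e P) (MvPolynomial.expand e Q))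
    (hMD : ∀ {f g : MvPolynomial (Fin p) k} {d : Fin p →₀ ℕ} {c : k}, c ≠ 0 →
      f * g = MvPolynomial.monomial d c → ∃ (d' : Fin p →₀ ℕ) (c' : k), c' ≠ 0 ∧ f = MvPolynomial.monomial d' c')
    (θ : E ≃+* E) (hθexp : ∀ x, θ (exp x) = exp (θ x))
    (hθk : ∀ z, z ∈ k ↔ θ z ∈ k) (hθY'' : ∀ y, y ∈ Y'' ↔ θ y ∈ Y'')
    {N : ℕ} (hN : 0 < N) {z : E} {P Q : MvPolynomial (Fin p) k} (hrel : IsRelPrime P Q)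
    (hQ : MvPolynomial.aeval (fun i => exp ((1 / (N : ℚ)) • b i)) Q ≠ 0)
    (hz : z * MvPolynomial.aeval (fun i => exp ((1 / (N : ℚ)) • b i)) Q =
      MvPolynomial.aeval (fun i => exp ((1 / (N : ℚ)) • b i)) P)
    {c₀ y₀ : E} (hc₀ : c₀ ∈ k) (hc₀0 : c₀ ≠ 0) (hy₀ : y₀ ∈ Y'') (hsemi : θ z = (c₀ * exp y₀) * z) :
    ∃ c ∈ k, c ≠ 0 ∧ ∃ y ∈ Y'',
      θ (MvPolynomial.aeval (fun i => exp ((1 / (N : ℚ)) • b i)) Q) =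
        (c * exp y) * MvPolynomial.aeval (fun i => exp ((1 / (N : ℚ)) • b i)) Q := by
  sorry

/-- **Stub 7a — Case II, the core claim ("difference algebra of a branch shift"; HARDEST, lead).**
Abstract over an algebraically closed exponential field `E` of characteristic `0` with cyclic kernel
`τℤ`.  Data: a finitely generated strong `ℚ`-subspace `X ∋ τ`; an L-step `ℓ` over `X` (`exp ℓ`
algebraic over the Γ-field `ℚ(gens X)`, `ℓ` not); a subspace `U ⊇ V := X + ℚℓ` obtained from `V` by
finitely many A-steps `v i` (each algebraic over the Γ-field of the previous space and outside it), in
which `X` is A-closed (`U ∩ acl (gens X) = X`); an automorphism `θ` of the exponential field `E`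
which is the identity on `X`, shifts the branch `ℓ ↦ ℓ + qτ` (`q ∈ ℚ ∖ 0`) and stabilises `U`.
Claim: every `θ`-fixed element of `U` lies in `X`.  (Then, in the reduction stub, the minimal `δ = 0`
hull of a core-fixed `a` cannot contain an L-step, i.e. it is an EA-chain space, so `a ∈ C_EA`.)
Proof route (work/CaseII-plan.md §B): canonical level tower `Y₀ = V`, `Yₛ₊₁ = U ∩ acl (gens Yₛ)`;
induction on the level of simultaneous statements (Fixₛ) "no `θⁿ`-fixed element of `Yₛ₊₁ ∖ Yₛ`" and
(Monoₛ) "no `θⁿ`-fixed monomial `r·exp w`, `r ∈ acl (gens Yₛ)ˣ`, `w ∈ Yₛ₊₁ ∖ Yₛ`"; level `0` is the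
affine-kill lemma (landed `caseII_affineKill`) over `B = acl (gens X)` on which `θ` is locally finite;
higher levels: minimal polynomials over the `θ`-stable fields `acl(gens Yₛ₋₁)(exp Yₛ)`, lowest-terms
fractions in the group algebra of `Yₛ/Yₛ₋₁` (UFD of `MvPolynomial` + persistence of coprimality under
`X ↦ Xᵉ`), support of semi-invariant polynomials, descent of coefficients level by level. -/
theorem stub_caseII_core {E : Type} [Field E] [CharZero E] [ExponentialRing E] [IsAlgClosed E]
    (τ : E) (hker : expKernel E = AddSubgroup.zmultiples τ) (hτ : τ ≠ 0)
    (X : Submodule ℚ E) (hτX : τ ∈ X) (hXfg : X.FG) (hXs : IsStrong X)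
    (ℓ : E) (hℓexp : exp ℓ ∈ acl (gens X)) (hℓ : ℓ ∉ acl (gens X))
    (U : Submodule ℚ E) {s : ℕ} (v : Fin s → E)
    (hU : U = (X ⊔ Submodule.span ℚ {ℓ}) ⊔ Submodule.span ℚ (range v))
    (hvA : ∀ i : Fin s,
      v i ∉ (X ⊔ Submodule.span ℚ {ℓ}) ⊔ Submodule.span ℚ (v '' Set.Iio i) ∧
      v i ∈ acl (gens ((X ⊔ Submodule.span ℚ {ℓ}) ⊔ Submodule.span ℚ (v '' Set.Iio i))))
    (hXclosed : ∀ u ∈ U, u ∈ acl (gens X) → u ∈ X)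
    (θ : E ≃+* E) (hθexp : ∀ x, θ (exp x) = exp (θ x)) (hθX : ∀ x ∈ X, θ x = x)
    (q : ℚ) (hq : q ≠ 0) (hθℓ : θ ℓ = ℓ + q • τ)
    (hθU : ∀ u, u ∈ U ↔ θ u ∈ U) :
    ∀ a ∈ U, θ a = a → a ∈ X := by
  sorry

/-- **Stub 7b′ — Case II, the branch-shifting automorphism** (zero-dimensional Zilber fields; M).
In a Zilber field `F` which is its own `ecl ∅`, with kernel `τℤ`: if `X = ℚτ + ℚc` is strong and `ℓ`
is an L-step over `X` (`exp ℓ` algebraic over the Γ-field `ℚ(gens X)`, `ℓ` not), then some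
exponential field automorphism `θ` of `F` fixes `c` and `τ` and shifts the branch, `θ ℓ = ℓ + m τ`
with `m ≥ 1`.  Route: the log shift `(c, ℓ) ↦ (c, ℓ + m τ)` is a Γ-isomorphism over `ℚτ`
(`Theorems.RigidCore.logShift_isGammaIso`, from the Kummer fact), between tuples spanning the SAME
strong space `X + ℚℓ` (`CaseIICore.isStrong_base`); hull-to-closure
`ZilberAutomorphisms.exists_isEIsoOn_of_isGammaIsoTw₂` (over `IsEBaseIso₂.refl`) realises it by an
E-isomorphism `g` between `ecl`-closed sets, both equal to `univ` because `ecl ∅ = univ`; `g` is then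
a ring automorphism commuting with `exp`, the identity on `ℚ^{ab}(τ)` (so `g τ = τ`). -/
theorem stub_caseII_shiftAut {F : Type} [Field F] [CharZero F] [ExponentialRing F]
    (hE : IsZilberField F) (huniv : ecl (∅ : Set F) = Set.univ)
    {τ : F} (hker : expKernel F = AddSubgroup.zmultiples τ)
    {N : ℕ} (c : Fin N → F)
    (hXs : IsStrong (Submodule.span ℚ ({τ} : Set F) ⊔ Submodule.span ℚ (range c)))
    {ℓ : F} (hℓexp : exp ℓ ∈ acl (gens (Submodule.span ℚ ({τ} : Set F) ⊔ Submodule.span ℚ (range c))))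
    (hℓ : ℓ ∉ acl (gens (Submodule.span ℚ ({τ} : Set F) ⊔ Submodule.span ℚ (range c)))) :
    ∃ (θ : F ≃+* F) (m : ℕ), 0 < m ∧ (∀ x, θ (exp x) = exp (θ x)) ∧ (∀ j, θ (c j) = c j) ∧
      θ τ = τ ∧ θ ℓ = ℓ + (m : ℚ) • τ := by
  sorry

/-- **Stub 7b — Case II, reduction to the core claim** (zero-dimensional Zilber fields; M/L).  In a
Zilber field `E` which is its own `ecl ∅` (so that Γ-isomorphisms of strong tuples extend to GLOBAL
exponential automorphisms, `ZilberAutomorphisms.exists_isEIsoOn_of_isGammaIsoTw₂` + `ecl ∅ = univ`),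
granted the core claim `stub_caseII_core` for `E` (hypothesis `hcore`, verbatim), every element `a` of
the ELA-core of `E` (smallest subfield containing the kernel generator `τ`, closed under `exp`, under
logarithms and relatively algebraically closed) which is fixed by every exponential automorphism of
`E` lies in the EA-core (the same without logarithms).  Route (work/CaseII-plan.md §A): (1) `a` lies in
the span of a strong E/L/A-chain over `Λ₀ = ℚτ` (the union of chain spans is an ELA-closed subfield
∋ τ; `Λ₀` strong by `hE.schanuelProperty`, `schanuelProperty_iff_isStrong_span_kernelGenerator`);
(2) the least `δ = 0` subspace `H ∋ τ, a` (δ = 0 subspaces ∋ Λ₀ are closed under `⊓` by submodularity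
`predim_sup_le`) is a chain space (echelon lemma: δ = 0 subspaces of chain spaces are chain spaces)
and is `θ`-stable for every exponential automorphism `θ` fixing `a`; (3) in A-priority normal form
`H = P ⊕ ℚℓ₁ ⊕ A₁ ⊕ ⋯ ⊕ ℚℓᵣ ⊕ Aᵣ`; if `r = 0`, `a ∈ P ⊆ C_EA`; else put `X := P ⊕ ⋯ ⊕ Aᵣ₋₁`
(A-closed in `H`), `ℓ := ℓᵣ`: the log shift `(c̄, ℓ) ↦ (c̄, ℓ + mτ)` (landed abstract
`logShift_isGammaIso`) extends along the A-steps (`IsGammaIsoTw.exists_append_single_of_mem_acl`) and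
globalises to `θ` with `θ|X = id`, `θ ℓ = ℓ + mτ`, `θ a = a`, hence `θ H = H`; `hcore` gives `a ∈ X`,
so `H ≤ X < H` — contradiction. -/
theorem stub_caseII_reduce {E : Type} [Field E] [CharZero E] [ExponentialRing E]
    (hE : IsZilberField E) (huniv : ecl (∅ : Set E) = Set.univ)
    (τ : E) (hker : expKernel E = AddSubgroup.zmultiples τ)
    (hcore : ∀ (X : Submodule ℚ E), τ ∈ X → X.FG → IsStrong X →
      ∀ (ℓ : E), exp ℓ ∈ acl (gens X) → ℓ ∉ acl (gens X) →
      ∀ (U : Submodule ℚ E) (s : ℕ) (v : Fin s → E),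
        U = (X ⊔ Submodule.span ℚ {ℓ}) ⊔ Submodule.span ℚ (range v) →
        (∀ i : Fin s,
          v i ∉ (X ⊔ Submodule.span ℚ {ℓ}) ⊔ Submodule.span ℚ (v '' Set.Iio i) ∧
          v i ∈ acl (gens ((X ⊔ Submodule.span ℚ {ℓ}) ⊔ Submodule.span ℚ (v '' Set.Iio i)))) →
        (∀ u ∈ U, u ∈ acl (gens X) → u ∈ X) →
        ∀ (θ : E ≃+* E), (∀ x, θ (exp x) = exp (θ x)) → (∀ x ∈ X, θ x = x) →
          ∀ (q : ℚ), q ≠ 0 → θ ℓ = ℓ + q • τ → (∀ u, u ∈ U ↔ θ u ∈ U) →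
            ∀ a ∈ U, θ a = a → a ∈ X) :
    ∀ a : E,
      a ∈ (sInf {K : IntermediateField ℚ E | τ ∈ K ∧ (∀ w ∈ K, exp w ∈ K) ∧
          (∀ w : E, IsAlgebraic K w → w ∈ K) ∧ (∀ w : E, exp w ∈ K → w ∈ K)} :
            IntermediateField ℚ E) →
      (∀ θ : E ≃+* E, (∀ x, θ (exp x) = exp (θ x)) → θ a = a) →
        a ∈ (sInf {K : IntermediateField ℚ E | τ ∈ K ∧ (∀ w ∈ K, exp w ∈ K) ∧
          (∀ w : E, IsAlgebraic K w → w ∈ K)} : IntermediateField ℚ E) := by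
  sorry

/-- **Stub 7c — Case II, transfer from the countable core to `ℂ`** (M).  Under Zilber's conjecture
the subfield `C₀ = ecl ∅ ⊆ ℂ` with the induced exponential (`Khovanskii.eclSubfield.instExponentialRing`)
is itself a Zilber field (`IsZilberField.eclSubfield_isZilberField`) and its own `ecl ∅`
(`Khovanskii.eclSubfield.image_ecl`); its kernel is generated by `⟨2πi, _⟩`.  Granted the abstract
Case II for every zero-dimensional Zilber field (hypothesis `habs` = the conclusion of
`stub_caseII_reduce`, universally quantified), the `ℂ`-level statement follows: a core-fixed
`a ∈ ecl ∅` (fixed by every `g` with `IsEIsoOn g (ecl ∅) (ecl ∅)`) is fixed by every exponential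
automorphism of the subfield `C₀` (such an automorphism is the restriction of its own extension by
zero/identity, cf. `Theorems/RigidCoreAclSubsetLogFreeCoreResiduePresentations.lean`,
`isEIsoOn_extend_equiv`); `a ∈ C_ELA(ℂ)` gives `⟨a, _⟩ ∈ C_ELA(C₀)` and `⟨a, _⟩ ∈ C_EA(C₀)` gives
`a ∈ logFreeCore` (the members of the two families correspond by `K ↦ K ∩ C₀`, `K' ↦ K'`, because
`C₀` is relatively algebraically closed, exp- and log-closed in `ℂ`; `logFreeCore = sInf {…}` by
`rfl`, `Negative.LogFreeCoreObjects`). -/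
theorem stub_caseII_transfer (hZ : IsZilberField ℂ) (τ : ℂ) (hτ : τ = 2 * ↑Real.pi * Complex.I)
    (habs : ∀ (E : Type) [Field E] [CharZero E] [ExponentialRing E],
      IsZilberField E → ecl (∅ : Set E) = Set.univ →
      ∀ (τE : E), expKernel E = AddSubgroup.zmultiples τE →
      ∀ a : E,
        a ∈ (sInf {K : IntermediateField ℚ E | τE ∈ K ∧ (∀ w ∈ K, exp w ∈ K) ∧
            (∀ w : E, IsAlgebraic K w → w ∈ K) ∧ (∀ w : E, exp w ∈ K → w ∈ K)} :
              IntermediateField ℚ E) →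
        (∀ θ : E ≃+* E, (∀ x, θ (exp x) = exp (θ x)) → θ a = a) →
          a ∈ (sInf {K : IntermediateField ℚ E | τE ∈ K ∧ (∀ w ∈ K, exp w ∈ K) ∧
            (∀ w : E, IsAlgebraic K w → w ∈ K)} : IntermediateField ℚ E)) :
    ∀ a ∈ ecl (∅ : Set ℂ),
      a ∈ (sInf {K : IntermediateField ℚ ℂ | (2 * ↑Real.pi * Complex.I : ℂ) ∈ K ∧
          (∀ w ∈ K, Complex.exp w ∈ K) ∧ (∀ w : ℂ, IsAlgebraic K w → w ∈ K) ∧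
          (∀ w : ℂ, Complex.exp w ∈ K → w ∈ K)} : IntermediateField ℚ ℂ) →
      (∀ g : ℂ → ℂ, IsEIsoOn g (ecl (∅ : Set ℂ)) (ecl (∅ : Set ℂ)) → g a = a) →
        a ∈ (logFreeCore : Set ℂ) := by
  -- CLOSED (c1, p104120): `Theorems/RigidCoreAclSubsetLogFreeCoreCaseIITransfer.lean`
  -- (`Summit.Schanuel.Schanuel.Theorems.RigidCore.stub_caseII_transfer hZ τ hτ habs`; kept as a
  -- stub in this registration copy until the farm has built that module)
  sorry

/-- Case II assembled from the three stubs (replaces the former monolithic `stub_caseII`). -/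
theorem caseII_of_stubs (hZ : IsZilberField ℂ) (τ : ℂ) (hτ : τ = 2 * ↑Real.pi * Complex.I) :
    ∀ a ∈ ecl (∅ : Set ℂ),
      a ∈ (sInf {K : IntermediateField ℚ ℂ | (2 * ↑Real.pi * Complex.I : ℂ) ∈ K ∧
          (∀ w ∈ K, Complex.exp w ∈ K) ∧ (∀ w : ℂ, IsAlgebraic K w → w ∈ K) ∧
          (∀ w : ℂ, Complex.exp w ∈ K → w ∈ K)} : IntermediateField ℚ ℂ) →
      (∀ g : ℂ → ℂ, IsEIsoOn g (ecl (∅ : Set ℂ)) (ecl (∅ : Set ℂ)) → g a = a) →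
        a ∈ (logFreeCore : Set ℂ) :=
  stub_caseII_transfer hZ τ hτ fun E _ _ _ hE huniv τE hkerE => by
    haveI := hE.isAlgClosed
    -- the kernel generator is non-zero: the standard kernel is generated by a transcendental
    have hτE : τE ≠ 0 := by
      obtain ⟨τ₀, hτ₀, hker₀⟩ := hE.hasStandardKernel
      intro h0
      have hmem : τ₀ ∈ expKernel E := by rw [hker₀]; exact AddSubgroup.mem_zmultiples τ₀
      rw [hkerE, h0, AddSubgroup.zmultiples_zero_eq_bot, AddSubgroup.mem_bot] at hmem
      exact hτ₀ (hmem ▸ isAlgebraic_zero)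
    exact stub_caseII_reduce hE huniv τE hkerE fun X hτX hXfg hXs ℓ hℓexp hℓ U s v hU hvA hXclosed θ
        hθexp hθX q hq hθℓ hθU =>
      stub_caseII_core τE hkerE hτE X hτX hXfg hXs ℓ hℓexp hℓ U v hU hvA hXclosed θ hθexp hθX q hq
        hθℓ hθU

/-! ## Closed stubs of the original skeleton (landed by lead -0), kept for the record -/

/-- `acl(∅) ⊆ ecl(∅)` under EAC — CLOSED (p71976). -/
theorem aclSubsetEcl_of_eac : IsExpAlgClosed ℂ → expAcl ⊆ ecl (∅ : Set ℂ) :=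
  Summit.Schanuel.Schanuel.Theorems.RigidCore.stub_aclSubsetEcl_of_eac

/-- Core automorphisms are elementary for `∅`-definable sets under EAC — CLOSED (p72100). -/
theorem coreAut_elementary_of_eac :
    IsExpAlgClosed ℂ →
      ∀ g : ℂ → ℂ, IsEIsoOn g (ecl (∅ : Set ℂ)) (ecl (∅ : Set ℂ)) →
        ∀ s : Set ℂ, Set.Definable₁ (∅ : Set ℂ) Language.expRing s →
          ∀ a ∈ ecl (∅ : Set ℂ), (a ∈ s ↔ g a ∈ s) :=
  Summit.Schanuel.Schanuel.Theorems.RigidCore.stub_coreAut_elementary_of_eac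

/-! ## Glue (sorry-free) -/

/-- The kernel of the complex exponential is `2πiℤ` (tree vocabulary). -/
theorem expKernel_complex_eq_zmultiples :
    expKernel ℂ = AddSubgroup.zmultiples (2 * ↑Real.pi * Complex.I : ℂ) := by
  ext x
  rw [mem_expKernel_complex_iff, AddSubgroup.mem_zmultiples_iff]
  constructor
  · rintro ⟨n, hn⟩
    exact ⟨n, by rw [hn, zsmul_eq_mul]⟩
  · rintro ⟨n, rfl⟩
    exact ⟨n, by rw [zsmul_eq_mul]⟩

/-- `2πi ≠ 0`. -/
theorem two_pi_I_ne_zero : (2 * ↑Real.pi * Complex.I : ℂ) ≠ 0 := by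
  have hπ : (Real.pi : ℂ) ≠ 0 := Complex.ofReal_ne_zero.2 Real.pi_ne_zero
  simp [hπ, Complex.I_ne_zero]

/-- **Hull-to-core** (proved; = `Theorems/RigidCoreAclSubsetLogFreeCoreHullToCore.lean` once landed):
under Zilber's conjecture a Γ-isomorphism over the identity of `ℚ^{ab}(2πi)` between strong tuples is
realised by an exponential-field automorphism of `ecl ∅` (`ZilberAutomorphisms.exists_isEIsoOn_of_isGammaIsoTw₂`
restricted to the prime closure, `IsEIsoOn.restrict`). -/
theorem hullToCore (hZ : IsZilberField ℂ) (τ : ℂ) (hτ : τ = 2 * ↑Real.pi * Complex.I) {N : ℕ} {c c' : Fin N → ℂ}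
    (hiso : IsGammaIsoTw₂
      (RingEquiv.refl (fieldOf (Submodule.span ℚ ({τ} : Set ℂ)))) c c')
    (hs : IsStrong (Submodule.span ℚ ({τ} : Set ℂ) ⊔ Submodule.span ℚ (range c)))
    (hs' : IsStrong (Submodule.span ℚ ({τ} : Set ℂ) ⊔ Submodule.span ℚ (range c'))) :
    ∃ g : ℂ → ℂ, IsEIsoOn g (ecl (∅ : Set ℂ)) (ecl (∅ : Set ℂ)) ∧ ∀ j, g (c j) = c' j := by
  subst hτ
  obtain ⟨g, hg, hgc, -⟩ := ZilberAutomorphisms.exists_isEIsoOn_of_isGammaIsoTw₂ hZ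
    expKernel_complex_eq_zmultiples expKernel_complex_eq_zmultiples two_pi_I_ne_zero
    two_pi_I_ne_zero (IsEBaseIso₂.refl _) hiso hs hs'
  have h0 := hg.restrict (Set.empty_subset _)
  rw [Set.image_empty] at h0
  exact ⟨g, h0, hgc⟩

/-- **The doubling principle** (Stubs 3 + 4 + 5: base, model, realisation): under Zilber's conjecture a free strong extension
`e` of `X = ℚ·2πi + ℚc ◁ ℂ` of predimension `0` has a Γ-isomorphic partner `e'` over `c` (identity on
the base), again strong, in general position with respect to `e` modulo `X`. -/
theorem doubling (hZ : IsZilberField ℂ) (τ : ℂ) (hτ : τ = 2 * ↑Real.pi * Complex.I) {N k : ℕ} (c : Fin N → ℂ) (e : Fin k → ℂ)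
    (hX : IsStrong (Submodule.span ℚ ({τ} : Set ℂ) ⊔ Submodule.span ℚ (range c)))
    (hW : IsStrong (Submodule.span ℚ ({τ} : Set ℂ) ⊔
      Submodule.span ℚ (range (Fin.append c e))))
    (hlin : LinIndepOver (Submodule.span ℚ ({τ} : Set ℂ) ⊔
      Submodule.span ℚ (range c)) e)
    (hδ : predim (Submodule.span ℚ ({τ} : Set ℂ) ⊔ Submodule.span ℚ (range c))
      (Submodule.span ℚ (range e)) = 0)
    (hfree : ∀ m : Fin k → ℤ, m ≠ 0 →
      (∑ j, (m j : ℚ) • e j) ∉ acl (gens (Submodule.span ℚ ({τ} : Set ℂ) ⊔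
        Submodule.span ℚ (range c))) ∧
      Complex.exp (∑ j, (m j : ℚ) • e j) ∉ acl (gens (Submodule.span ℚ ({τ} : Set ℂ) ⊔
        Submodule.span ℚ (range c)))) :
    ∃ e' : Fin k → ℂ,
      IsGammaIsoTw₂ (RingEquiv.refl (fieldOf (Submodule.span ℚ ({τ} : Set ℂ))))
        (Fin.append c e) (Fin.append c e') ∧
      IsStrong (Submodule.span ℚ ({τ} : Set ℂ) ⊔
        Submodule.span ℚ (range (Fin.append c e'))) ∧
      ∀ q : Fin k → ℚ, q ≠ 0 →
        (∑ j, q j • (e' j - e j)) ∉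
          Submodule.span ℚ ({τ} : Set ℂ) ⊔ Submodule.span ℚ (range c) := by
  obtain ⟨F, hFW, K, _, _, D, θ, t, j₁, j₂, hK, hjτ, hagree, hD, hθ, hstrong, hnov⟩ :=
    stub_doubleBase τ hτ c e hX hlin hfree
  have hrank := stub_doubleRank τ c e hX hlin hδ F hFW K D θ t j₁ j₂ hK hjτ hagree hD hθ
  obtain ⟨M, _, _, _, τ₁, σ₀, c₁, e₁, e₂, hker, hτ₁, hσ₀, h₁, h₂, hsM, hδM, hnew⟩ :=
    stub_doubleModel τ c e hX hlin hδ F hFW K D θ t j₁ j₂ hK hjτ hagree hD hθ hstrong hnov hrank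
  exact stub_realiseCopy hZ τ hτ M τ₁ hker hτ₁ σ₀ hσ₀ c₁ e₁ e₂ c e h₁ h₂ hsM hδM hnew hX hW hδ

/-- **The residue (A₀) under Zilber's conjecture** (Case I + Case II): the fixed field of
`Aut_E(ecl ∅)` lies in the log-free core. -/
theorem coreFixedField_logFree_of_zilber (hZ : IsZilberField ℂ) (τ : ℂ) (hτ : τ = 2 * ↑Real.pi * Complex.I) :
    ∀ a ∈ ecl (∅ : Set ℂ),
      (∀ g : ℂ → ℂ, IsEIsoOn g (ecl (∅ : Set ℂ)) (ecl (∅ : Set ℂ)) → g a = a) →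
        a ∈ (logFreeCore : Set ℂ) :=
  fun a ha hfix =>
    caseII_of_stubs hZ τ hτ a ha
      (stub_caseI hZ τ hτ (fun hiso hs hs' => hullToCore hZ τ hτ hiso hs hs')
        (fun c e => doubling hZ τ hτ c e) a ha hfix)
      hfix

/-- The residue stub of the ORIGINAL skeleton, now a consequence of the reshaped stubs. -/
theorem stub_coreFixedField_logFree_of_stubs :
    ∀ a ∈ ecl (∅ : Set ℂ),
      (∀ g : ℂ → ℂ, IsEIsoOn g (ecl (∅ : Set ℂ)) (ecl (∅ : Set ℂ)) → g a = a) →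
        a ∈ (logFreeCore : Set ℂ) :=
  coreFixedField_logFree_of_zilber stub_zilber (2 * ↑Real.pi * Complex.I) rfl

/-! ## The composition: the crux BY NAME -/

/-- **`AclSubsetLogFreeCore_of` — THE SKELETON THEOREM**: the crux `RigidCore.AclSubsetLogFreeCore`
BY NAME, from the registered stubs through the landed transfer theorem
`aclSubsetLogFreeCore_of_eac_of_coreFixedField` (p72771: (A) ⟸ EAC ∧ (A₀)); EAC is
`stub_zilber.isStronglyExpAlgClosed.isExpAlgClosed`, (A₀) is `coreFixedField_logFree_of_zilber`. -/
theorem AclSubsetLogFreeCore_of :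
    Summit.Schanuel.Schanuel.Theses.RigidCore.AclSubsetLogFreeCore :=
  Summit.Schanuel.Schanuel.Theorems.RigidCore.aclSubsetLogFreeCore_of_eac_of_coreFixedField
    stub_zilber.isStronglyExpAlgClosed.isExpAlgClosed
    (coreFixedField_logFree_of_zilber stub_zilber (2 * ↑Real.pi * Complex.I) rfl)

end Summit.Schanuel.Schanuel.Cruxes.AclSubsetLogFreeCore.EacExtendsCoreAutomorphisms
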